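/-
Copyright: the b2b-balaban T⁴-continuum CRUX team, row NE7b OWNER lineage `t4-ne7b-p1` (gen 134). Project licence.
-/
import Summits.QuantumFields.BalabanUV.T4Continuum.Spine.NE7b.SupEffectiveActionLocalExpansion

/-!
# THE WHOLE KOTECKÝ–PREISS LAYER OF THE ROAD NEEDS ONLY AN ACTIVITY ON CONNECTED CELL SETS — ON ANY FINITE POLYMER FAMILY: for an
# abstract activity `z : Finset V → ℂ` vanishing off the `R`-connected cell sets with `‖z Y‖ ≤ ε^{#Y}` (`R` symmetric with `≤ Δ`
# neighbours) and ANY finite family `L` of polymers, the gas `Ξ(L; z)` is zero-free with two-sided volume-uniform exclusion costs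
# `e^{∓#D(Δ+1)2eε}` (`eε(Δ+1)² ≤ 1∕2`), `exp(log Ξ(L)) = Ξ(L)`, the `τ`-weighted pinned cluster sums are `≤ #X(Δ+1)2e^{1+τ}ε`
# (`e^{1+τ}ε(Δ+1)² ≤ 1∕2`), and when the polymers of `L` are nonempty subsets of a cell set `C` (`L ⊆ 𝒫(C)`): `‖log Ξ(L)‖ ≤ #C(Δ+1)2eε`,
# `‖log Ξ(L) − Σ_{‖𝒞‖<m}Φ^T(𝒞)‖ ≤ e^{−τm}#C(Δ+1)2e^{1+τ}ε`, and two such activities agreeing on the polymers avoiding `D` have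
# `‖log Ξ(L;z) − log Ξ(L;z')‖ ≤ 2#D(Δ+1)2eε` — (287) §3–4, (311) §1 and (312) with `connActivity ↦ z` and `𝒫(C) ↦ L`, which is the
# format of (349)'s RESUMMED POLYMER-LOCAL GAS (activity `⋃_*M` on the image of the union map, small like `ε′^{#Y}` by (350)∕(351)):
# SCOPING-d5 (3c) «(289)∕(296)∕(311)∕(312) re-run on the resummed gas», the abstract half (row NE7b, node U5c; the tree's
# `geomInc_dobrushin` ∕ `isKPVolume_geomInc` ∕ `geomInc_kp_hypothesis` ∕ `geomInc_kp_sum_le` ∕ `exp_polymerLogZ_of_kp` ∕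
# `touchSum_le_of_forall_scaleAt` BY NAME; [folklore])

Cell `pub-balaban`, sub-cell `t4`, spine estimate NE7b (`T4WeightBudget.RelWeightBound`; the cell's OWN estimate — NOT PRINTED in
[Bałaban 1983–89], NOT PROVED).  Crux-route work under `Spine/NE7b/` by the row OWNER (`t4-ne7b-p1` gen 134, file (352)) under FREEZE
(0)'s crux-prover clause, on `g131/records/SCOPING-d5-reentry.md` (3c) and § [NE7bP1-G131-ADDENDUM] NEXT (3)(a)(ii); NOTHING of Bałaban's
is named as a Lean object, valued or asserted; no `T4Continuum/Support` leaf typed; no `def`, no notation; zero `sorry`.  Imports (BY NAME):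
the OWNER's (312) `…SupEffectiveActionLocalExpansion` (`smallness_of_decay`) and through it (287); the tree's `PolymerGas`
(`polymerPartitionFunction_ne_zero_and_ratio_le`, `norm_polymerPartitionFunction_sdiff_div_le_exp`), `PolymerGasGeometric` (`geomInc_dobrushin`,
`sum_kpWeight_le_of_touches`, `kpWeight_nonneg`, `geomInc_refl`, `geomInc_symm`), `LocalPerturbationClusterExpansion` (`isKPVolume_geomInc`,
`geomInc_kp_hypothesis`, `geomInc_kp_sum_le`, `exists_kpTouches_singleton`, `symm_of_inst`), `ClusterExpansion` (`exp_polymerLogZ_of_kp`,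
`le_norm_polymerPartitionFunction_sdiff_div_of_kp`, `polymerLogZ_eq_sum_truncatedWeight`, `truncatedWeight_congr`, `kpTerm`),
`ClusterExpansionKPBound` (`touchSum`, `touchSum_le_of_forall_scaleAt`, `touchSum_smul_le_of_kp`, `multCube`, `mem_multCube`),
`ClusterExpansionActivityPaths` (`scaledActivity_one`, `scaleAt_mem_Icc`), `PolymerPressure` (`truncatedWeight_empty`).

WHY (located).  (349) pushed the polymer-local gas forward to a gas of `R`-connected cell sets whose activity `⋃_*M` is NOT the
`connActivity` of one-factor-per-cell data and whose polymer family is the IMAGE of the union map, not `𝒫(C)`; (287)∕(311)∕(312) are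
stated for `connActivity R μ g` on `𝒫(C)`.  Their proofs, however, go through the tree's abstract Kotecký–Preiss lemmas, which take any
activity with `hz0 : ¬IsRConnected R Y → z Y = 0`, `hz : ‖z Y‖ ≤ ε^{#Y}` and any finite family; this file records the layer once at
that level, so that (353) instantiates it with (349)∕(350)∕(351) and every later activity (the next step's `K⁺`) re-enters by name.

WHAT IS PROVED ([folklore]; `hz0`, `hz`, `0 ≤ ε`, `R` symmetric with `≤ Δ` neighbours throughout; `‖𝒞‖ = Σ_{Y∈𝒞}#Y`):
* §1 Dobrushin on ANY family `L` (`eε(Δ+1)² ≤ 1∕2`): **`ne_zero`** (`Ξ(L; z) ≠ 0`), **`norm_sdiff_div_le`** (removing the polymers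
  meeting `D` costs `≤ e^{#D(Δ+1)2eε}`), `norm_sdiff_le`;
* §2 the KP layer on ANY family `L`: **`exp_polymerLogZ`** (`exp(log Ξ(L)) = Ξ(L)`), **`exp_neg_le_norm_sdiff_div`** (lower exclusion
  cost), **`touchSum_decay_le`** (`Σ_{𝒞⊆L pinned at X}‖Φ^T(𝒞)‖e^{τ‖𝒞‖} ≤ #X(Δ+1)2e^{1+τ}ε` under `e^{1+τ}ε(Δ+1)² ≤ 1∕2`),
  `sum_norm_truncatedWeight_touching_le` (`τ = 0`), **`sum_norm_truncatedWeight_large_pinned_le`** (`‖𝒞‖ ≥ m` costs `e^{−τm}`);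
* §3 extensive statements for `L ⊆ 𝒫(C)`: **`sum_norm_truncatedWeight_large_le`**, **`norm_polymerLogZ_le`** (`‖log Ξ(L)‖ ≤ #C(Δ+1)2eε`),
  **`norm_polymerLogZ_sub_smallClusters_le`** (`‖log Ξ(L) − Σ_{‖𝒞‖<m}Φ^T(𝒞)‖ ≤ e^{−τm}#C(Δ+1)2e^{1+τ}ε`), `smallClusters_congr`;
* §4 LOCALITY on ANY family: **`norm_polymerLogZ_sub_le_of_agree`** (`z = z'` on the polymers of `L` disjoint from `D` ⟹
  `‖log Ξ(L;z) − log Ξ(L;z')‖ ≤ 2#D(Δ+1)2eε`); §5 consistency: `connActivity_hypotheses` ((287)'s data satisfy `hz0`∕`hz`), so (287) §4,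
  (311) §1 and (312) are the instances `z = M^{conn}`, `L = 𝒫(C)` (not restated); §6 toy.

HONEST (what this is NOT).  Bookkeeping: the tree's abstract KP lemmas assembled at the activity level with a free polymer family; no measure,
no Gaussian, no estimate of any factor (the polymer-local instance with (348)–(351)'s letters is (353)); scalar skeleton ((A3), NC-NE7b-α
UNRULED); nothing of Bałaban's asserted.  BY-NAME EFFECT ON THE WALL: NONE.  NE7b NOT PRINTED ∕ NOT PROVED; spine PROVED 0∕9; rung (B)+1 — the
programme's measures remain FINITE-torus statements; NOT the mass gap, NOT Clay.  HONEST DEPENDENCY: continuum YM on T⁴ ⇐ BetaPertH ∧ nine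
spine estimates (0∕9 proved); BetaPertH ⇐ (D1) ∧ (D4) ∧ CAP+tail; G-an2-4 gates asym, D1 and NE2∕3∕4.
-/

set_option autoImplicit false

noncomputable section

namespace Summit.QuantumFields.BalabanUV.T4Continuum.NE7b.SupPolymerActivityExpansion

open MeasureTheory Finset Real
open scoped BigOperators
open Literature.Probability.LatticeModels
open SupEffectiveActionLocalExpansion (smallness_of_decay)

variable {V : Type*} [DecidableEq V] {R : V → V → Prop} [DecidableRel R] {z z' : Finset V → ℂ} {ε τ : ℝ}
  {nbr : V → Finset V} {Δ : ℕ}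

/-! ## §1. Dobrushin's criterion on any finite polymer family -/

/-- **ZERO-FREENESS ON ANY FAMILY**: `R` symmetric with `≤ Δ` neighbours, `z` vanishing off `R`-connected sets with `‖z Y‖ ≤ ε^{#Y}`,
`0 ≤ ε`, `eε(Δ+1)² ≤ 1∕2` ⟹ `Ξ(L; z) ≠ 0` for every finite family `L` of cell sets. [folklore] -/
theorem ne_zero (hR : ∀ x y, R x y → R y x) (hΔ : ∀ x, (nbr x).card ≤ Δ) (hnbr : ∀ x y, R x y → y ∈ nbr x)
    (hz0 : ∀ Y, ¬ IsRConnected R Y → z Y = 0) (hz : ∀ Y, ‖z Y‖ ≤ ε ^ Y.card) (hε : 0 ≤ ε)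
    (hsmall : Real.exp 1 * ε * ((Δ : ℝ) + 1) ^ 2 ≤ 1 / 2) (L : Finset (Finset V)) :
    polymerPartitionFunction (GeomInc R) z L ≠ 0 :=
  (polymerPartitionFunction_ne_zero_and_ratio_le (inc := GeomInc R) (geomInc_refl R) (fun _ _ hXY => geomInc_symm R hR hXY) _ _
    (kpWeight_nonneg R (mul_nonneg (Real.exp_pos 1).le hε)) (geomInc_dobrushin hR hΔ hnbr hε hsmall z hz0 hz) _).1

/-- **THE EXCLUSION COST IS VOLUME-UNIFORM ON ANY FAMILY**: removing from `L` the polymers meeting a cell set `D` costs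
`‖Ξ(L ∖ L_D; z)∕Ξ(L; z)‖ ≤ exp(#D·(Δ+1)·2eε)`. [folklore] -/
theorem norm_sdiff_div_le (hR : ∀ x y, R x y → R y x) (hΔ : ∀ x, (nbr x).card ≤ Δ) (hnbr : ∀ x y, R x y → y ∈ nbr x)
    (hz0 : ∀ Y, ¬ IsRConnected R Y → z Y = 0) (hz : ∀ Y, ‖z Y‖ ≤ ε ^ Y.card) (hε : 0 ≤ ε)
    (hsmall : Real.exp 1 * ε * ((Δ : ℝ) + 1) ^ 2 ≤ 1 / 2) (L : Finset (Finset V)) (D : Finset V) :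
    ‖polymerPartitionFunction (GeomInc R) z (L \ L.filter fun Y => (Y ∩ D).Nonempty) / polymerPartitionFunction (GeomInc R) z L‖ ≤
      Real.exp (D.card * ((Δ : ℝ) + 1) * (2 * (Real.exp 1 * ε))) := by
  set lam : ℝ := Real.exp 1 * ε with hlam_def
  have hlam : 0 ≤ lam := mul_nonneg (Real.exp_pos 1).le hε
  have hsmall' : ((Δ : ℝ) + 1) ^ 2 * lam ≤ 1 / 2 := by rw [hlam_def]; linarith [hsmall]
  refine (norm_polymerPartitionFunction_sdiff_div_le_exp (inc := GeomInc R) (geomInc_refl R) (fun _ _ hXY => geomInc_symm R hR hXY) _ _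
    (kpWeight_nonneg R hlam) (geomInc_dobrushin hR hΔ hnbr hε hsmall z hz0 hz) L (L.filter fun Y => (Y ∩ D).Nonempty)).trans ?_
  refine Real.exp_le_exp.2 (sum_kpWeight_le_of_touches hR hΔ hnbr hlam hsmall' D _ fun Y hY => ?_)
  obtain ⟨q, hq⟩ := (mem_filter.1 hY).2
  exact Or.inr ⟨q, (mem_inter.1 hq).2, q, (mem_inter.1 hq).1, Or.inl rfl⟩

/-- In particular `‖Ξ(L ∖ L_D)‖ ≤ exp(#D(Δ+1)2eε)·‖Ξ(L)‖`. [folklore] -/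
theorem norm_sdiff_le (hR : ∀ x y, R x y → R y x) (hΔ : ∀ x, (nbr x).card ≤ Δ) (hnbr : ∀ x y, R x y → y ∈ nbr x)
    (hz0 : ∀ Y, ¬ IsRConnected R Y → z Y = 0) (hz : ∀ Y, ‖z Y‖ ≤ ε ^ Y.card) (hε : 0 ≤ ε)
    (hsmall : Real.exp 1 * ε * ((Δ : ℝ) + 1) ^ 2 ≤ 1 / 2) (L : Finset (Finset V)) (D : Finset V) :
    ‖polymerPartitionFunction (GeomInc R) z (L \ L.filter fun Y => (Y ∩ D).Nonempty)‖ ≤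
      Real.exp (D.card * ((Δ : ℝ) + 1) * (2 * (Real.exp 1 * ε))) * ‖polymerPartitionFunction (GeomInc R) z L‖ := by
  have hne := ne_zero hR hΔ hnbr hz0 hz hε hsmall L
  have := norm_sdiff_div_le hR hΔ hnbr hz0 hz hε hsmall L D
  rw [norm_div, div_le_iff₀ (norm_pos_iff.2 hne)] at this
  exact this

/-! ## §2. The Kotecký–Preiss layer on any finite polymer family -/

/-- **`exp(log Ξ(L)) = Ξ(L)`** (the KP branch) on any family, under `eε(Δ+1)² ≤ 1∕2`; `R` symmetric as an instance so that the tree's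
KP lemmas (for `[Std.Refl] [Std.Symm]` incompatibilities) apply to `GeomInc R`. [folklore] -/
theorem exp_polymerLogZ [Std.Symm R] (hΔ : ∀ x, (nbr x).card ≤ Δ) (hnbr : ∀ x y, R x y → y ∈ nbr x)
    (hz0 : ∀ Y, ¬ IsRConnected R Y → z Y = 0) (hz : ∀ Y, ‖z Y‖ ≤ ε ^ Y.card) (hε : 0 ≤ ε)
    (hsmall : Real.exp 1 * ε * ((Δ : ℝ) + 1) ^ 2 ≤ 1 / 2) (L : Finset (Finset V)) :
    Complex.exp (polymerLogZ (GeomInc R) z L) = polymerPartitionFunction (GeomInc R) z L :=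
  exp_polymerLogZ_of_kp (isKPVolume_geomInc symm_of_inst hΔ hnbr hε hsmall z hz0 hz L) subset_rfl

/-- **Lower exclusion cost**: `exp(−#D(Δ+1)2eε) ≤ ‖Ξ(L ∖ L_D)∕Ξ(L)‖` on any family. [folklore] -/
theorem exp_neg_le_norm_sdiff_div [Std.Symm R] (hΔ : ∀ x, (nbr x).card ≤ Δ) (hnbr : ∀ x y, R x y → y ∈ nbr x)
    (hz0 : ∀ Y, ¬ IsRConnected R Y → z Y = 0) (hz : ∀ Y, ‖z Y‖ ≤ ε ^ Y.card) (hε : 0 ≤ ε)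
    (hsmall : Real.exp 1 * ε * ((Δ : ℝ) + 1) ^ 2 ≤ 1 / 2) (L : Finset (Finset V)) (D : Finset V) :
    Real.exp (-(D.card * ((Δ : ℝ) + 1) * (2 * (Real.exp 1 * ε)))) ≤
      ‖polymerPartitionFunction (GeomInc R) z (L \ L.filter fun Y => (Y ∩ D).Nonempty) / polymerPartitionFunction (GeomInc R) z L‖ := by
  have hR : ∀ x y, R x y → R y x := symm_of_inst
  refine le_trans (Real.exp_le_exp.2 (neg_le_neg ?_))
    (le_norm_polymerPartitionFunction_sdiff_div_of_kp (isKPVolume_geomInc hR hΔ hnbr hε hsmall z hz0 hz L) subset_rfl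
      (filter_subset _ _))
  have hsum := geomInc_kp_sum_le hR hΔ hnbr hε (τ := 0) (by simpa using hsmall) z hz0 hz D (L.filter fun Y => (Y ∩ D).Nonempty)
    fun Y hY => by
      obtain ⟨q, hq⟩ := (mem_filter.1 hY).2
      exact Or.inr ⟨q, (mem_inter.1 hq).1, q, (mem_inter.1 hq).2, Or.inl rfl⟩
  simp only [zero_mul, add_zero] at hsum
  refine le_trans (sum_le_sum fun X _ => ?_) (by simpa using hsum)
  unfold kpTerm
  rfl

/-- **THE `τ`-WEIGHTED PINNED CLUSTER SUMS ARE `O(ε)` ON ANY FAMILY**: `0 ≤ τ`, `e^{1+τ}ε(Δ+1)² ≤ 1∕2` ⟹ for every finite family `L`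
and every cell set `X`, `Σ_{𝒞 ⊆ L, 𝒞 pinned at X} ‖Φ^T(𝒞)‖·e^{τΣ_{Y∈𝒞}#Y} ≤ #X·(Δ+1)·2e^{1+τ}ε` ([KP86, (4)] with `d(Y) = τ#Y`). [folklore] -/
theorem touchSum_decay_le (hR : ∀ x y, R x y → R y x) (hΔ : ∀ x, (nbr x).card ≤ Δ) (hnbr : ∀ x y, R x y → y ∈ nbr x)
    (hz0 : ∀ Y, ¬ IsRConnected R Y → z Y = 0) (hz : ∀ Y, ‖z Y‖ ≤ ε ^ Y.card) (hε : 0 ≤ ε) (hτ : 0 ≤ τ)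
    (hsmall : Real.exp (1 + τ) * ε * ((Δ : ℝ) + 1) ^ 2 ≤ 1 / 2) (L : Finset (Finset V)) (X : Finset V) :
    ∑ 𝒞 ∈ L.powerset with KPTouches (GeomInc R) 𝒞 X, ‖truncatedWeight (GeomInc R) z 𝒞‖ * Real.exp (∑ Y ∈ 𝒞, τ * (Y.card : ℝ))
      ≤ X.card * ((Δ : ℝ) + 1) * (2 * (Real.exp (1 + τ) * ε)) := by
  haveI : Std.Symm R := ⟨hR⟩
  have h1 : ∀ γ ∈ L, ∑ γ' ∈ L with GeomInc R γ' γ,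
      ‖z γ'‖ * Real.exp ((γ'.card : ℝ) + (fun Y : Finset V => τ * (Y.card : ℝ)) γ') ≤ (γ.card : ℝ) := by
    intro γ hγ
    have := geomInc_kp_hypothesis hR hΔ hnbr hε hsmall z hz0 hz L γ hγ
    simpa using this
  have ha : ∀ γ : Finset V, 0 ≤ (γ.card : ℝ) := fun γ => Nat.cast_nonneg _
  have hd : ∀ γ : Finset V, 0 ≤ (fun Y : Finset V => τ * (Y.card : ℝ)) γ := fun γ => by positivity
  have hKP : IsKPVolume (GeomInc R) z (fun X => (X.card : ℝ)) L :=
    isKPVolume_geomInc hR hΔ hnbr hε (smallness_of_decay hε hτ hsmall) z hz0 hz L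
  have hS : ∀ t ∈ Set.Icc (0 : ℝ) 1, ∀ δ ∈ L, GeomInc R δ X →
      touchSum (GeomInc R) (scaledActivity z (scaleAt (GeomInc R) (fun _ => (1 : ℝ)) X t)) (fun Y : Finset V => τ * (Y.card : ℝ)) L δ
        ≤ (δ.card : ℝ) := by
    intro t ht δ hδ _
    have hc : scaleAt (GeomInc R) (fun _ => (1 : ℝ)) X t ∈ multCube (Finset V) 1 :=
      mem_multCube.2 fun δ' => scaleAt_mem_Icc (fun _ => ⟨zero_le_one, le_rfl⟩) X ht δ'
    have := touchSum_smul_le_of_kp ha hd h1 1 ⟨zero_le_one, le_rfl⟩ _ hc δ hδ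
    rwa [one_smul] at this
  have hmain := touchSum_le_of_forall_scaleAt (inc := GeomInc R) hd hKP (c := fun _ => (1 : ℝ)) (fun _ => ⟨zero_le_one, le_rfl⟩)
    (γ := X) hS
  rw [scaledActivity_one] at hmain
  have hlhs : touchSum (GeomInc R) z (fun Y : Finset V => τ * (Y.card : ℝ)) L X =
      ∑ 𝒞 ∈ L.powerset with KPTouches (GeomInc R) 𝒞 X, ‖truncatedWeight (GeomInc R) z 𝒞‖ * Real.exp (∑ Y ∈ 𝒞, τ * (Y.card : ℝ)) := rfl
  rw [hlhs] at hmain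
  refine hmain.trans ?_
  exact geomInc_kp_sum_le hR hΔ hnbr hε hsmall z hz0 hz X (L.filter fun Y => GeomInc R Y X) fun Y hY => (mem_filter.1 hY).2

/-- **PINNED CLUSTER SUMS ARE `O(ε)` ON ANY FAMILY** (`τ = 0`): `eε(Δ+1)² ≤ 1∕2` ⟹ `Σ_{𝒞 ⊆ L pinned at X}‖Φ^T(𝒞)‖ ≤ #X(Δ+1)2eε`. [folklore] -/
theorem sum_norm_truncatedWeight_touching_le (hR : ∀ x y, R x y → R y x) (hΔ : ∀ x, (nbr x).card ≤ Δ)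
    (hnbr : ∀ x y, R x y → y ∈ nbr x) (hz0 : ∀ Y, ¬ IsRConnected R Y → z Y = 0) (hz : ∀ Y, ‖z Y‖ ≤ ε ^ Y.card) (hε : 0 ≤ ε)
    (hsmall : Real.exp 1 * ε * ((Δ : ℝ) + 1) ^ 2 ≤ 1 / 2) (L : Finset (Finset V)) (X : Finset V) :
    ∑ 𝒞 ∈ L.powerset with KPTouches (GeomInc R) 𝒞 X, ‖truncatedWeight (GeomInc R) z 𝒞‖ ≤ X.card * ((Δ : ℝ) + 1) * (2 * (Real.exp 1 * ε)) := by
  have h := touchSum_decay_le hR hΔ hnbr hz0 hz hε le_rfl (τ := 0) (by simpa using hsmall) L X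
  simpa using h

/-- **LARGE CLUSTERS PINNED AT `X` ARE EXPONENTIALLY RARE ON ANY FAMILY**: `Σ_{𝒞 ⊆ L pinned at X, m ≤ ‖𝒞‖}‖Φ^T(𝒞)‖ ≤ e^{−τm}·#X(Δ+1)2e^{1+τ}ε`.
[folklore] -/
theorem sum_norm_truncatedWeight_large_pinned_le (hR : ∀ x y, R x y → R y x) (hΔ : ∀ x, (nbr x).card ≤ Δ)
    (hnbr : ∀ x y, R x y → y ∈ nbr x) (hz0 : ∀ Y, ¬ IsRConnected R Y → z Y = 0) (hz : ∀ Y, ‖z Y‖ ≤ ε ^ Y.card) (hε : 0 ≤ ε)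
    (hτ : 0 ≤ τ) (hsmall : Real.exp (1 + τ) * ε * ((Δ : ℝ) + 1) ^ 2 ≤ 1 / 2) (L : Finset (Finset V)) (X : Finset V) (m : ℝ) :
    ∑ 𝒞 ∈ L.powerset with KPTouches (GeomInc R) 𝒞 X ∧ m ≤ ∑ Y ∈ 𝒞, (Y.card : ℝ), ‖truncatedWeight (GeomInc R) z 𝒞‖
      ≤ Real.exp (-(τ * m)) * (X.card * ((Δ : ℝ) + 1) * (2 * (Real.exp (1 + τ) * ε))) := by
  have h := touchSum_decay_le hR hΔ hnbr hz0 hz hε hτ hsmall L X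
  have hstep : Real.exp (τ * m) * ∑ 𝒞 ∈ L.powerset with KPTouches (GeomInc R) 𝒞 X ∧ m ≤ ∑ Y ∈ 𝒞, (Y.card : ℝ),
      ‖truncatedWeight (GeomInc R) z 𝒞‖ ≤
      ∑ 𝒞 ∈ L.powerset with KPTouches (GeomInc R) 𝒞 X, ‖truncatedWeight (GeomInc R) z 𝒞‖ * Real.exp (∑ Y ∈ 𝒞, τ * (Y.card : ℝ)) := by
    rw [mul_sum]
    calc ∑ 𝒞 ∈ L.powerset with KPTouches (GeomInc R) 𝒞 X ∧ m ≤ ∑ Y ∈ 𝒞, (Y.card : ℝ), Real.exp (τ * m) * ‖truncatedWeight (GeomInc R) z 𝒞‖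
        ≤ ∑ 𝒞 ∈ L.powerset with KPTouches (GeomInc R) 𝒞 X ∧ m ≤ ∑ Y ∈ 𝒞, (Y.card : ℝ),
          ‖truncatedWeight (GeomInc R) z 𝒞‖ * Real.exp (∑ Y ∈ 𝒞, τ * (Y.card : ℝ)) := by
          refine sum_le_sum fun 𝒞 h𝒞 => ?_
          obtain ⟨-, -, hm⟩ := mem_filter.1 h𝒞
          rw [mul_comm]
          refine mul_le_mul_of_nonneg_left (exp_le_exp.2 ?_) (norm_nonneg _)
          rw [← mul_sum]
          exact mul_le_mul_of_nonneg_left hm hτ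
      _ ≤ _ := sum_le_sum_of_subset_of_nonneg (fun 𝒞 h𝒞 => by
            simp only [mem_filter] at h𝒞 ⊢
            exact ⟨h𝒞.1, h𝒞.2.1⟩) fun _ _ _ => by positivity
  have hexp : 0 < Real.exp (τ * m) := exp_pos _
  rw [Real.exp_neg, ← div_eq_inv_mul, le_div_iff₀ hexp, mul_comm]
  exact hstep.trans h

/-! ## §3. Extensive statements for families of nonempty polymers inside a cell set `C` -/

/-- **LARGE CLUSTERS ARE EXPONENTIALLY RARE, EXTENSIVELY**: `L ⊆ 𝒫(C)`, `0 < m` ⟹ `Σ_{𝒞 ⊆ L, m ≤ ‖𝒞‖}‖Φ^T(𝒞)‖ ≤ e^{−τm}·#C(Δ+1)2e^{1+τ}ε`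
(every nonempty cluster is pinned at a singleton `{p}`, `p ∈ C`). [folklore] -/
theorem sum_norm_truncatedWeight_large_le (hR : ∀ x y, R x y → R y x) (hΔ : ∀ x, (nbr x).card ≤ Δ)
    (hnbr : ∀ x y, R x y → y ∈ nbr x) (hz0 : ∀ Y, ¬ IsRConnected R Y → z Y = 0) (hz : ∀ Y, ‖z Y‖ ≤ ε ^ Y.card) (hε : 0 ≤ ε)
    (hτ : 0 ≤ τ) (hsmall : Real.exp (1 + τ) * ε * ((Δ : ℝ) + 1) ^ 2 ≤ 1 / 2) {L : Finset (Finset V)} {C : Finset V}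
    (hL : L ⊆ rconnSubsets R C) {m : ℝ} (hm : 0 < m) :
    ∑ 𝒞 ∈ L.powerset with m ≤ ∑ Y ∈ 𝒞, (Y.card : ℝ), ‖truncatedWeight (GeomInc R) z 𝒞‖
      ≤ Real.exp (-(τ * m)) * (C.card * ((Δ : ℝ) + 1) * (2 * (Real.exp (1 + τ) * ε))) := by
  classical
  set Φ : Finset (Finset V) → ℂ := truncatedWeight (GeomInc R) z with hΦ
  calc ∑ 𝒞 ∈ L.powerset with m ≤ ∑ Y ∈ 𝒞, (Y.card : ℝ), ‖Φ 𝒞‖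
      ≤ ∑ 𝒞 ∈ L.powerset with m ≤ ∑ Y ∈ 𝒞, (Y.card : ℝ), ∑ p ∈ C with KPTouches (GeomInc R) 𝒞 {p}, ‖Φ 𝒞‖ := by
        refine sum_le_sum fun 𝒞 h𝒞 => ?_
        obtain ⟨h𝒞L, hm𝒞⟩ := mem_filter.1 h𝒞
        have hne : 𝒞.Nonempty := by
          by_contra hnot
          rw [not_nonempty_iff_eq_empty.1 hnot, sum_empty] at hm𝒞
          linarith
        obtain ⟨p, hpC, hp⟩ := exists_kpTouches_singleton ((mem_powerset.1 h𝒞L).trans hL) hne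
        have hmem : p ∈ C.filter fun p => KPTouches (GeomInc R) 𝒞 {p} := mem_filter.2 ⟨hpC, hp⟩
        calc ‖Φ 𝒞‖ = ∑ q ∈ ({p} : Finset V), ‖Φ 𝒞‖ := by simp
          _ ≤ _ := sum_le_sum_of_subset_of_nonneg (by simpa using hmem) fun _ _ _ => norm_nonneg _
    _ = ∑ p ∈ C, ∑ 𝒞 ∈ (L.powerset.filter fun 𝒞 => m ≤ ∑ Y ∈ 𝒞, (Y.card : ℝ)) with KPTouches (GeomInc R) 𝒞 {p}, ‖Φ 𝒞‖ := by
        rw [sum_comm' (t' := C) (s' := fun p => (L.powerset.filter fun 𝒞 => m ≤ ∑ Y ∈ 𝒞, (Y.card : ℝ)).filter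
          fun 𝒞 => KPTouches (GeomInc R) 𝒞 {p})]
        intro 𝒞 p
        simp only [mem_filter]
        tauto
    _ = ∑ p ∈ C, ∑ 𝒞 ∈ L.powerset with KPTouches (GeomInc R) 𝒞 {p} ∧ m ≤ ∑ Y ∈ 𝒞, (Y.card : ℝ), ‖Φ 𝒞‖ := by
        refine sum_congr rfl fun p _ => ?_
        rw [filter_filter]
        refine sum_congr (filter_congr fun 𝒞 _ => and_comm) fun _ _ => rfl
    _ ≤ ∑ p ∈ C, Real.exp (-(τ * m)) * ((({p} : Finset V).card : ℝ) * ((Δ : ℝ) + 1) * (2 * (Real.exp (1 + τ) * ε))) :=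
        sum_le_sum fun p _ => sum_norm_truncatedWeight_large_pinned_le hR hΔ hnbr hz0 hz hε hτ hsmall L {p} m
    _ = Real.exp (-(τ * m)) * (C.card * ((Δ : ℝ) + 1) * (2 * (Real.exp (1 + τ) * ε))) := by
        simp only [card_singleton, Nat.cast_one, one_mul, sum_const, nsmul_eq_mul]
        ring

/-- **EXTENSIVITY OF `log Ξ` WITH AN `O(ε)` DENSITY, FOR ANY FAMILY OF NONEMPTY POLYMERS INSIDE `C`**: `L ⊆ 𝒫(C)`, `eε(Δ+1)² ≤ 1∕2` ⟹
`‖log Ξ(L; z)‖ ≤ #C(Δ+1)2eε`, uniformly in the volume. [folklore] -/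
theorem norm_polymerLogZ_le (hR : ∀ x y, R x y → R y x) (hΔ : ∀ x, (nbr x).card ≤ Δ) (hnbr : ∀ x y, R x y → y ∈ nbr x)
    (hz0 : ∀ Y, ¬ IsRConnected R Y → z Y = 0) (hz : ∀ Y, ‖z Y‖ ≤ ε ^ Y.card) (hε : 0 ≤ ε)
    (hsmall : Real.exp 1 * ε * ((Δ : ℝ) + 1) ^ 2 ≤ 1 / 2) {L : Finset (Finset V)} {C : Finset V} (hL : L ⊆ rconnSubsets R C) :
    ‖polymerLogZ (GeomInc R) z L‖ ≤ C.card * ((Δ : ℝ) + 1) * (2 * (Real.exp 1 * ε)) := by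
  classical
  set Φ : Finset (Finset V) → ℂ := truncatedWeight (GeomInc R) z with hΦ
  rw [polymerLogZ_eq_sum_truncatedWeight]
  have hsplit : ∑ 𝒞 ∈ L.powerset, Φ 𝒞 = ∑ 𝒞 ∈ L.powerset with 𝒞.Nonempty, Φ 𝒞 := by
    rw [sum_filter]
    refine sum_congr rfl fun 𝒞 _ => ?_
    split_ifs with hne
    · rfl
    · rw [not_nonempty_iff_eq_empty.1 hne, hΦ, truncatedWeight_empty]
  rw [hsplit]
  refine (norm_sum_le _ _).trans ?_
  calc ∑ 𝒞 ∈ L.powerset with 𝒞.Nonempty, ‖Φ 𝒞‖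
      ≤ ∑ 𝒞 ∈ L.powerset with 𝒞.Nonempty, ∑ p ∈ C with KPTouches (GeomInc R) 𝒞 {p}, ‖Φ 𝒞‖ := by
        refine sum_le_sum fun 𝒞 h𝒞 => ?_
        obtain ⟨h𝒞L, hne⟩ := mem_filter.1 h𝒞
        obtain ⟨p, hpC, hp⟩ := exists_kpTouches_singleton ((mem_powerset.1 h𝒞L).trans hL) hne
        have hmem : p ∈ C.filter fun p => KPTouches (GeomInc R) 𝒞 {p} := mem_filter.2 ⟨hpC, hp⟩
        calc ‖Φ 𝒞‖ = ∑ q ∈ ({p} : Finset V), ‖Φ 𝒞‖ := by simp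
          _ ≤ _ := sum_le_sum_of_subset_of_nonneg (by simpa using hmem) fun _ _ _ => norm_nonneg _
    _ ≤ ∑ 𝒞 ∈ L.powerset, ∑ p ∈ C with KPTouches (GeomInc R) 𝒞 {p}, ‖Φ 𝒞‖ :=
        sum_le_sum_of_subset_of_nonneg (filter_subset _ _) fun _ _ _ => sum_nonneg fun _ _ => norm_nonneg _
    _ = ∑ p ∈ C, ∑ 𝒞 ∈ L.powerset with KPTouches (GeomInc R) 𝒞 {p}, ‖Φ 𝒞‖ := by
        rw [sum_comm' (t' := C) (s' := fun p => L.powerset.filter fun 𝒞 => KPTouches (GeomInc R) 𝒞 {p})]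
        intro 𝒞 p
        simp only [mem_filter]
        tauto
    _ ≤ ∑ p ∈ C, (({p} : Finset V).card : ℝ) * ((Δ : ℝ) + 1) * (2 * (Real.exp 1 * ε)) :=
        sum_le_sum fun p _ => sum_norm_truncatedWeight_touching_le hR hΔ hnbr hz0 hz hε hsmall L {p}
    _ = C.card * ((Δ : ℝ) + 1) * (2 * (Real.exp 1 * ε)) := by
        simp only [card_singleton, Nat.cast_one, one_mul, sum_const, nsmul_eq_mul]
        ring

/-- **THE LOCAL EXPANSION WITH AN EXPONENTIALLY SMALL EXTENSIVE REMAINDER, FOR ANY FAMILY OF NONEMPTY POLYMERS INSIDE `C`**: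
`‖log Ξ(L; z) − Σ_{𝒞 ⊆ L, ‖𝒞‖ < m}Φ^T(𝒞)‖ ≤ e^{−τm}·#C(Δ+1)2e^{1+τ}ε`. [folklore] -/
theorem norm_polymerLogZ_sub_smallClusters_le (hR : ∀ x y, R x y → R y x) (hΔ : ∀ x, (nbr x).card ≤ Δ)
    (hnbr : ∀ x y, R x y → y ∈ nbr x) (hz0 : ∀ Y, ¬ IsRConnected R Y → z Y = 0) (hz : ∀ Y, ‖z Y‖ ≤ ε ^ Y.card) (hε : 0 ≤ ε)
    (hτ : 0 ≤ τ) (hsmall : Real.exp (1 + τ) * ε * ((Δ : ℝ) + 1) ^ 2 ≤ 1 / 2) {L : Finset (Finset V)} {C : Finset V}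
    (hL : L ⊆ rconnSubsets R C) {m : ℝ} (hm : 0 < m) :
    ‖polymerLogZ (GeomInc R) z L - ∑ 𝒞 ∈ L.powerset with ∑ Y ∈ 𝒞, (Y.card : ℝ) < m, truncatedWeight (GeomInc R) z 𝒞‖
      ≤ Real.exp (-(τ * m)) * (C.card * ((Δ : ℝ) + 1) * (2 * (Real.exp (1 + τ) * ε))) := by
  rw [polymerLogZ_eq_sum_truncatedWeight, ← sum_filter_add_sum_filter_not L.powerset (fun 𝒞 => ∑ Y ∈ 𝒞, (Y.card : ℝ) < m),
    add_sub_cancel_left]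
  have hcongr : (L.powerset.filter fun 𝒞 => ¬ ∑ Y ∈ 𝒞, (Y.card : ℝ) < m) = L.powerset.filter fun 𝒞 => m ≤ ∑ Y ∈ 𝒞, (Y.card : ℝ) :=
    filter_congr fun 𝒞 _ => not_lt
  rw [hcongr]
  exact (norm_sum_le _ _).trans (sum_norm_truncatedWeight_large_le hR hΔ hnbr hz0 hz hε hτ hsmall hL hm)

omit [DecidableRel R] in
/-- **THE RETAINED TERMS ARE LOCAL**: the small-cluster sum depends only on the activities of the polymers of `L` of size `< m`. [folklore] -/
theorem smallClusters_congr [DecidableRel R] (L : Finset (Finset V)) (m : ℝ) (hagree : ∀ Y ∈ L, (Y.card : ℝ) < m → z Y = z' Y) :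
    ∑ 𝒞 ∈ L.powerset with ∑ Y ∈ 𝒞, (Y.card : ℝ) < m, truncatedWeight (GeomInc R) z 𝒞 =
      ∑ 𝒞 ∈ L.powerset with ∑ Y ∈ 𝒞, (Y.card : ℝ) < m, truncatedWeight (GeomInc R) z' 𝒞 := by
  refine sum_congr rfl fun 𝒞 h𝒞 => truncatedWeight_congr fun Y hY => ?_
  obtain ⟨h𝒞L, hsmall⟩ := mem_filter.1 h𝒞
  have hYm : (Y.card : ℝ) < m :=
    lt_of_le_of_lt (single_le_sum (f := fun Y : Finset V => (Y.card : ℝ)) (fun _ _ => Nat.cast_nonneg _) hY) hsmall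
  exact hagree Y (mem_powerset.1 h𝒞L hY) hYm

/-! ## §4. Locality: activities agreeing off `D` -/

/-- **LOCALITY OF `log Ξ` IN THE ACTIVITY, ON ANY FAMILY.**  Two activities vanishing off `R`-connected sets with `‖z Y‖, ‖z' Y‖ ≤ ε^{#Y}`
(`0 ≤ ε`, `eε(Δ+1)² ≤ 1∕2`) that AGREE on the polymers of `L` disjoint from `D` ⟹ `‖log Ξ(L; z) − log Ξ(L; z')‖ ≤ 2·#D·(Δ+1)·2eε`:
the clusters avoiding `D` cancel, the clusters pinned at `D` weigh `O(ε·#D)`. [folklore] -/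
theorem norm_polymerLogZ_sub_le_of_agree (hR : ∀ x y, R x y → R y x) (hΔ : ∀ x, (nbr x).card ≤ Δ)
    (hnbr : ∀ x y, R x y → y ∈ nbr x) (hz0 : ∀ Y, ¬ IsRConnected R Y → z Y = 0) (hz : ∀ Y, ‖z Y‖ ≤ ε ^ Y.card)
    (hz0' : ∀ Y, ¬ IsRConnected R Y → z' Y = 0) (hz' : ∀ Y, ‖z' Y‖ ≤ ε ^ Y.card) (hε : 0 ≤ ε)
    (hsmall : Real.exp 1 * ε * ((Δ : ℝ) + 1) ^ 2 ≤ 1 / 2) (L : Finset (Finset V)) (D : Finset V)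
    (hagree : ∀ Y ∈ L, Disjoint Y D → z Y = z' Y) :
    ‖polymerLogZ (GeomInc R) z L - polymerLogZ (GeomInc R) z' L‖ ≤ 2 * (D.card * ((Δ : ℝ) + 1) * (2 * (Real.exp 1 * ε))) := by
  classical
  set Φ : Finset (Finset V) → ℂ := truncatedWeight (GeomInc R) z with hΦ
  set Φ' : Finset (Finset V) → ℂ := truncatedWeight (GeomInc R) z' with hΦ'
  rw [polymerLogZ_eq_sum_truncatedWeight, polymerLogZ_eq_sum_truncatedWeight, ← sum_sub_distrib]
  -- clusters avoiding `D` cancel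
  have hvanish : ∀ 𝒞 ∈ L.powerset, Φ 𝒞 - Φ' 𝒞 ≠ 0 → ∃ q ∈ D, KPTouches (GeomInc R) 𝒞 {q} := by
    intro 𝒞 h𝒞 hne
    by_contra hnot
    refine hne (sub_eq_zero.2 (truncatedWeight_congr fun Y hY => ?_))
    have hYD : Disjoint Y D := Finset.disjoint_left.2 fun q hqY hqD =>
      hnot ⟨q, hqD, Y, hY, Or.inr ⟨q, hqY, q, mem_singleton_self q, Or.inl rfl⟩⟩
    exact hagree Y (mem_powerset.1 h𝒞 hY) hYD
  rw [← sum_filter_of_ne hvanish]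
  -- a nonnegative cluster functional summed over the clusters touching SOME cell of `D` is at most its pinned sums summed over `q ∈ D`
  have hpinned : ∀ a : Finset (Finset V) → ℝ, (∀ 𝒞, 0 ≤ a 𝒞) →
      ∑ 𝒞 ∈ L.powerset with ∃ q ∈ D, KPTouches (GeomInc R) 𝒞 {q}, a 𝒞 ≤ ∑ q ∈ D, ∑ 𝒞 ∈ L.powerset with KPTouches (GeomInc R) 𝒞 {q}, a 𝒞 := by
    intro a ha
    calc ∑ 𝒞 ∈ L.powerset with ∃ q ∈ D, KPTouches (GeomInc R) 𝒞 {q}, a 𝒞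
        ≤ ∑ 𝒞 ∈ L.powerset with ∃ q ∈ D, KPTouches (GeomInc R) 𝒞 {q}, ∑ q ∈ D with KPTouches (GeomInc R) 𝒞 {q}, a 𝒞 := by
          refine sum_le_sum fun 𝒞 h𝒞 => ?_
          obtain ⟨q, hqD, hq⟩ := (mem_filter.1 h𝒞).2
          have hmem : q ∈ D.filter fun q => KPTouches (GeomInc R) 𝒞 {q} := mem_filter.2 ⟨hqD, hq⟩
          calc a 𝒞 = ∑ q' ∈ ({q} : Finset V), a 𝒞 := by simp
            _ ≤ _ := sum_le_sum_of_subset_of_nonneg (by simpa using hmem) fun _ _ _ => ha 𝒞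
      _ ≤ ∑ 𝒞 ∈ L.powerset, ∑ q ∈ D with KPTouches (GeomInc R) 𝒞 {q}, a 𝒞 :=
          sum_le_sum_of_subset_of_nonneg (filter_subset _ _) fun _ _ _ => sum_nonneg fun _ _ => ha _
      _ = ∑ q ∈ D, ∑ 𝒞 ∈ L.powerset with KPTouches (GeomInc R) 𝒞 {q}, a 𝒞 := by
          rw [sum_comm' (t' := D) (s' := fun q => L.powerset.filter fun 𝒞 => KPTouches (GeomInc R) 𝒞 {q})]
          intro 𝒞 q
          simp only [mem_filter]
          tauto
  have hpin := sum_norm_truncatedWeight_touching_le hR hΔ hnbr hz0 hz hε hsmall L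
  have hpin' := sum_norm_truncatedWeight_touching_le hR hΔ hnbr hz0' hz' hε hsmall L
  calc ‖∑ 𝒞 ∈ L.powerset with ∃ q ∈ D, KPTouches (GeomInc R) 𝒞 {q}, (Φ 𝒞 - Φ' 𝒞)‖
      ≤ ∑ 𝒞 ∈ L.powerset with ∃ q ∈ D, KPTouches (GeomInc R) 𝒞 {q}, ‖Φ 𝒞 - Φ' 𝒞‖ := norm_sum_le _ _
    _ ≤ ∑ 𝒞 ∈ L.powerset with ∃ q ∈ D, KPTouches (GeomInc R) 𝒞 {q}, (‖Φ 𝒞‖ + ‖Φ' 𝒞‖) := sum_le_sum fun 𝒞 _ => norm_sub_le _ _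
    _ ≤ ∑ q ∈ D, ∑ 𝒞 ∈ L.powerset with KPTouches (GeomInc R) 𝒞 {q}, (‖Φ 𝒞‖ + ‖Φ' 𝒞‖) := hpinned _ fun 𝒞 => by positivity
    _ = ∑ q ∈ D, (∑ 𝒞 ∈ L.powerset with KPTouches (GeomInc R) 𝒞 {q}, ‖Φ 𝒞‖ + ∑ 𝒞 ∈ L.powerset with KPTouches (GeomInc R) 𝒞 {q}, ‖Φ' 𝒞‖) :=
        sum_congr rfl fun q _ => sum_add_distrib
    _ ≤ ∑ q ∈ D, ((({q} : Finset V).card : ℝ) * ((Δ : ℝ) + 1) * (2 * (Real.exp 1 * ε)) +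
          (({q} : Finset V).card : ℝ) * ((Δ : ℝ) + 1) * (2 * (Real.exp 1 * ε))) := sum_le_sum fun q _ => add_le_add (hpin {q}) (hpin' {q})
    _ = 2 * (D.card * ((Δ : ℝ) + 1) * (2 * (Real.exp 1 * ε))) := by
        simp only [card_singleton, Nat.cast_one, one_mul, sum_const, nsmul_eq_mul]
        ring

/-! ## §5. Consistency: (287)'s data are an instance -/

section Consistency

variable {Ω : Type*} {mΩ : MeasurableSpace Ω} {μ : Measure Ω} {g : V → Ω → ℂ}

omit [DecidableEq V] [DecidableRel R] in
/-- **(287)'s truncated activities satisfy the abstract hypotheses**: `‖M(K)‖ ≤ ε^{#K}` on `R`-connected `K` and `0 ≤ ε` ⟹ `M^{conn}` vanishes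
off `R`-connected sets and `‖M^{conn}(Y)‖ ≤ ε^{#Y}` everywhere — so §1–§4 with `z = M^{conn}`, `L = 𝒫(C)` are (287) §3–4, (311) §1 and (312)
(e.g. `norm_polymerLogZ_le … subset_rfl` is literally (287)'s `act_norm_pertLogZ_le`, not restated). [folklore] -/
theorem connActivity_hypotheses (hact : ∀ K : Finset V, IsRConnected R K → ‖cellActivity μ g K‖ ≤ ε ^ K.card) (hε : 0 ≤ ε) :
    (∀ Y, ¬ IsRConnected R Y → connActivity R μ g Y = 0) ∧ ∀ Y, ‖connActivity R μ g Y‖ ≤ ε ^ Y.card :=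
  ⟨fun Y hY => SupActivityPolymerGas.act_connActivity_eq_zero Y hY, fun Y => SupActivityPolymerGas.act_norm_connActivity_le hact hε Y⟩

end Consistency

/-! ## §6. Toy -/

/-- Toy (§3): on the EMPTY family the extensivity bound for `C = ∅` reads `‖log Ξ(∅)‖ ≤ 0`. -/
example (hR : ∀ x y, R x y → R y x) (hΔ : ∀ x, (nbr x).card ≤ Δ) (hnbr : ∀ x y, R x y → y ∈ nbr x)
    (hz0 : ∀ Y, ¬ IsRConnected R Y → z Y = 0) (hz : ∀ Y, ‖z Y‖ ≤ ε ^ Y.card) (hε : 0 ≤ ε)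
    (hsmall : Real.exp 1 * ε * ((Δ : ℝ) + 1) ^ 2 ≤ 1 / 2) : ‖polymerLogZ (GeomInc R) z (∅ : Finset (Finset V))‖ ≤ 0 := by
  have h := norm_polymerLogZ_le hR hΔ hnbr hz0 hz hε hsmall (L := ∅) (C := ∅) (empty_subset _)
  simpa using h

end Summit.QuantumFields.BalabanUV.T4Continuum.NE7b.SupPolymerActivityExpansion
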